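/-
Copyright: cell pub-rosobs (carver-g59). INSTRUMENT for engine 1's W(f) toy model — NOT a resolution theorem.
-/
import Mathlib.Algebra.MvPolynomial.CommRing
import Mathlib.Algebra.MvPolynomial.Variables
import Mathlib.RingTheory.MvPolynomial.Basic
import Mathlib.RingTheory.MvPolynomial.WeightedHomogeneous
import Mathlib.Algebra.Field.ZMod
import Mathlib.Data.Matrix.Basic
import Mathlib.Data.Matrix.Mul
import Mathlib.Data.Fin.VecNotation
import Mathlib.Tactic.LinearCombination
import Mathlib.Tactic.FinCases
import HarnessLib

/-!
# EXAMPLE L: a sharp (P)-system with a slot below `1/(p+1)` (THEOREM-LT §15, CARVER T71 (b)) — kernel-checked over `𝔽₃`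

Instrument — NOT a resolution theorem, NOT a statement about the invariant of [AbramovichTemkinWlodarczyk2024], NOT summit progress;
AI review weaker than expert review.  Engine 1's EXAMPLE L (THEOREM-LT-eng1-g38 §15; CARVER-NOTES-eng1-g38 T71 (b)) for the cell's `W(f)`
TOY MODEL at `p = 3`: slots `(f₁,f₂,f₃; W₁,W₂; y) = (X₀,X₁,X₂; X₃,X₄; X₅)` with weights `(⅓,⅓,⅓; ¼,¼; ⅙)`, the parameter `σ = X₆` of weight `1/12`,
  `g = f₁³ − W₁³W₂ + f₂²f₃ + y²f₃² + y⁶`,  `Φ = (f₁ += σW₁; W₂ += σ³)`.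
The engine's machine check `exL38` enumerated the graded automorphism group over `𝔽₃` class by class (REMARK S (1)); here every class is a
PROOF valid for all matrices at once (no enumeration), by the evaluation trick "a variable absent from `F` cannot influence the values of `F`":
* `aeval_isoVec_gL` — `Φ` is an isotropy: `g∘Φ = g` (Frobenius in characteristic `3`); `isWeightedHomogeneous_isoVec` — `Φ` is graded of degree
  `1/12` for the weights above (`σ ↦ σ`).
* CLASS `f` (truncation `N_{≥⅓} = f`, truncated face `F = f₁³ + f₂²f₃`): `mem_vars_F3_linF` — for every invertible `A` (given with a two-sided
  inverse `A'`) and every `m`, `f_m` occurs in `F∘A` ("`F` has no invariant direction"; `exL38`: all 11 232 `A ∈ GL₃(𝔽₃)`).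
* CLASS `W` (truncation `N_{≥¼} = f ⊔ W`, block-diagonal; the `W`-carrying part is `W₁³W₂`): `mem_vars_GW_linW` — for every invertible `B` and
  every `m`, `W_m` occurs in `(BW)₁³(BW)₂` (`exL38`: all 48 `B`).
* CLASS `y` (bottom): `mem_vars_gL_piL` — for every graded substitution of the shape `f ↦ Af + c·y²`, `W ↦ BW`, `y ↦ λy`, `σ ↦ σ` with `A`
  invertible and `λ ≠ 0` (no condition on `B`, `c`), `y` occurs in `g∘Π` (`exL38`: all 303 264 pairs `(A, c)`; the hand proof: the `y²`-part is the
  nonzero form `λ²u₃² + 2c₂u₂u₃ + c₃u₂²`).  Here: evaluate at `f = A'v`, `W = 0`, `y = t`; `t`-independence at `v = (0,0,s)`, `s = 0,1,2`,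
  is impossible for `λ ≠ 0` (a `decide` over `𝔽₃⁴` after the reduction).
NOT here: that EVERY graded automorphism for these weights has the shape `(A, c, B, λ)` (weight bookkeeping: the only weight-`⅓` monomial in
lighter variables is `y²`; the engine's remark, not typed), the passage "(P) for a class ⇔ bottom-pinning of the truncated face" (typed in
`WeightedCentreTruncation`: `slotPinned_iff_bottomPinned`), and the words "sharp", "(R0)", "THEOREM C3/U scope" (modelling).

References: weighted blow-ups / gradings [cite: AbramovichTemkinWlodarczyk2024, §5.1 (p. 1575)]; polynomial substitutions and evaluation
[cite: Lang2002, Ch. IV §1]; the example and its role are engine 1's, the formalisation ours.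
-/

open MvPolynomial

namespace Literature.AlgebraicGeometry.Resolution.WeightedBlowup

namespace ExampleL

/-- A variable absent from `F` does not influence the values of `F` (the evaluation trick used for every class; bookkeeping).
[cite: Lang2002, Ch. IV §1] -/
theorem eval_eq_eval_of_notMem_vars {n : ℕ} {F : MvPolynomial (Fin n) (ZMod 3)} {m : Fin n} (hF : m ∉ F.vars)
    (ε ε' : Fin n → ZMod 3) (h : ∀ i, i ≠ m → ε i = ε' i) : eval ε F = eval ε' F :=
  hom_congr_vars (by ext r; simp) (fun i hi _ => by rw [eval_X, eval_X]; exact h i fun him => hF (him ▸ hi)) rfl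

/-! ## The face, the isotropy, the weights -/

/-- EXAMPLE L's face `g = f₁³ − W₁³W₂ + f₂²f₃ + y²f₃² + y⁶` in `𝔽₃[f₁,f₂,f₃,W₁,W₂,y,σ]` (`σ = X₆` is the isotropy parameter; derived here from the
engine's text). [cite: AbramovichTemkinWlodarczyk2024, §5.1 (p. 1575)] -/
noncomputable def gL : MvPolynomial (Fin 7) (ZMod 3) :=
  X 0 ^ 3 - X 3 ^ 3 * X 4 + X 1 ^ 2 * X 2 + X 5 ^ 2 * X 2 ^ 2 + X 5 ^ 6

/-- The substitution `Φ = (f₁ ↦ f₁ + σW₁; W₂ ↦ W₂ + σ³)`, all other slots and `σ` fixed (derived here). [cite: AbramovichTemkinWlodarczyk2024, §5.1 (p. 1575)] -/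
noncomputable def isoVec : Fin 7 → MvPolynomial (Fin 7) (ZMod 3) :=
  ![X 0 + X 6 * X 3, X 1, X 2, X 3, X 4 + X 6 ^ 3, X 5, X 6]

/-- **`Φ` is an isotropy of `g`** (EXAMPLE L; "isotropy is `ring` in char 3": `(f₁ + σW₁)³ = f₁³ + σ³W₁³`; derived here).
[cite: AbramovichTemkinWlodarczyk2024, §5.1 (p. 1575)] -/
theorem aeval_isoVec_gL : aeval isoVec gL = gL := by
  have h3 : (3 : MvPolynomial (Fin 7) (ZMod 3)) = 0 := by
    simpa using CharP.cast_eq_zero (MvPolynomial (Fin 7) (ZMod 3)) 3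
  simp only [gL, isoVec, map_add, map_sub, map_mul, map_pow, aeval_X, Matrix.cons_val_zero, Matrix.cons_val_one,
    Matrix.cons_val]
  linear_combination (X 0 ^ 2 * X 6 * X 3 + X 0 * X 6 ^ 2 * X 3 ^ 2) * h3

/-- EXAMPLE L's weights `(⅓,⅓,⅓; ¼,¼; ⅙)` and the degree `1/12` of `σ` (derived here). [cite: AbramovichTemkinWlodarczyk2024, §5.1 (p. 1575)] -/
def wL : Fin 7 → ℚ := ![1/3, 1/3, 1/3, 1/4, 1/4, 1/6, 1/12]

/-- **`Φ` is GRADED of degree `1/12`**: every `Φ(X_i)` is weighted homogeneous of weight `w_i` when `σ` carries the weight `1/12`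
(`⅓ = 1/12 + ¼`, `¼ = 3·(1/12)`; derived here). [cite: AbramovichTemkinWlodarczyk2024, §5.1 (p. 1575)] -/
theorem isWeightedHomogeneous_isoVec (i : Fin 7) : IsWeightedHomogeneous wL (isoVec i) (wL i) := by
  have hX : ∀ j : Fin 7, IsWeightedHomogeneous wL (X j : MvPolynomial (Fin 7) (ZMod 3)) (wL j) :=
    fun j => isWeightedHomogeneous_X (ZMod 3) wL j
  fin_cases i
  · have h := (hX 6).mul (hX 3)
    have e : wL 6 + wL 3 = wL 0 := by simp [wL]; norm_num
    rw [e] at h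
    simpa [isoVec] using (hX 0).add h
  · simpa [isoVec] using hX 1
  · simpa [isoVec] using hX 2
  · simpa [isoVec] using hX 3
  · have h := (hX 6).pow 3
    have e : 3 • wL 6 = wL 4 := by simp [wL]; norm_num
    rw [e] at h
    simpa [isoVec] using (hX 4).add h
  · simpa [isoVec] using hX 5
  · simpa [isoVec] using hX 6

/-! ## Class `f`: `F = f₁³ + f₂²f₃` has no invariant direction over `𝔽₃` -/

/-- The truncated face of the class `f`: `F = f₁³ + f₂²f₃` (derived here). [cite: AbramovichTemkinWlodarczyk2024, §5.1 (p. 1575)] -/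
noncomputable def F3 : MvPolynomial (Fin 3) (ZMod 3) := X 0 ^ 3 + X 1 ^ 2 * X 2

/-- The linear substitution `f ↦ A f` (derived here). [cite: Lang2002, Ch. IV §1] -/
noncomputable def linF (A : Matrix (Fin 3) (Fin 3) (ZMod 3)) : Fin 3 → MvPolynomial (Fin 3) (ZMod 3) :=
  fun i => C (A i 0) * X 0 + C (A i 1) * X 1 + C (A i 2) * X 2

/-- Values of `F∘Π` (bookkeeping). [cite: Lang2002, Ch. IV §1] -/
theorem eval_aeval_F3 (π : Fin 3 → MvPolynomial (Fin 3) (ZMod 3)) (ε : Fin 3 → ZMod 3) :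
    eval ε (aeval π F3) = eval ε (π 0) ^ 3 + eval ε (π 1) ^ 2 * eval ε (π 2) := by
  simp only [F3, map_add, map_mul, map_pow, aeval_X]

/-- Values of the linear forms: `(A f)(ε) = (A ε)_i` (bookkeeping). [cite: Lang2002, Ch. IV §1] -/
theorem eval_linF (A : Matrix (Fin 3) (Fin 3) (ZMod 3)) (ε : Fin 3 → ZMod 3) (i : Fin 3) :
    eval ε (linF A i) = (A.mulVec ε) i := by
  simp [linF, Matrix.mulVec, dotProduct, Fin.sum_univ_three]

/-- Moving `v` by `s` times the `m`-th column of `A` moves `A'v` only in the coordinate `m` (`A'A = 1`; bookkeeping). [cite: Lang2002, Ch. III §5] -/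
theorem mulVec_add_smul_col_apply {n : ℕ} (A A' : Matrix (Fin n) (Fin n) (ZMod 3)) (hA' : A' * A = 1) (m : Fin n)
    (v : Fin n → ZMod 3) (s : ZMod 3) {i : Fin n} (hi : i ≠ m) :
    (A'.mulVec (v + s • fun j => A j m)) i = (A'.mulVec v) i := by
  have h1 : (A'.mulVec fun j => A j m) i = (A' * A) i m := by
    simp [Matrix.mulVec, dotProduct, Matrix.mul_apply]
  rw [Matrix.mulVec_add, Matrix.mulVec_smul, Pi.add_apply, Pi.smul_apply, h1, hA', Matrix.one_apply_ne hi, smul_zero, add_zero]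

/-- A column of an invertible matrix is nonzero (bookkeeping). [cite: Lang2002, Ch. III §5] -/
theorem col_ne_zero (A A' : Matrix (Fin 3) (Fin 3) (ZMod 3)) (hA' : A' * A = 1) (m : Fin 3) :
    ¬ (A 0 m = 0 ∧ A 1 m = 0 ∧ A 2 m = 0) := by
  rintro ⟨h0, h1, h2⟩
  have h := congrFun (congrFun hA' m) m
  rw [Matrix.mul_apply, Fin.sum_univ_three, h0, h1, h2, Matrix.one_apply_eq] at h
  simp at h

/-- **CLASS `f`** (EXAMPLE L; `exL38`: "all 11 232 `A ∈ GL₃(𝔽₃)`, `F∘A` involves every `f_i`"; derived here by proof): for `A` invertible, every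
`f_m` occurs in `F∘A`.  Proof: otherwise `F(v + s·A e_m) = F(v)` for all `v, s` (evaluate at `A'v`); the values at `v = 0, e₂, 2e₂, e₃`, `s = 1`
force `A e_m = 0`. [cite: AbramovichTemkinWlodarczyk2024, §5.1 (p. 1575)] -/
theorem mem_vars_F3_linF (A A' : Matrix (Fin 3) (Fin 3) (ZMod 3)) (hA : A * A' = 1) (hA' : A' * A = 1) (m : Fin 3) :
    m ∈ (aeval (linF A) F3).vars := by
  by_contra hm
  have H : ∀ (v : Fin 3 → ZMod 3) (s : ZMod 3),
      (v 0 + s * A 0 m) ^ 3 + (v 1 + s * A 1 m) ^ 2 * (v 2 + s * A 2 m) = v 0 ^ 3 + v 1 ^ 2 * v 2 := by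
    intro v s
    have E := eval_eq_eval_of_notMem_vars hm (A'.mulVec (v + s • fun j => A j m)) (A'.mulVec v)
      (fun i hi => mulVec_add_smul_col_apply A A' hA' m v s hi)
    rw [eval_aeval_F3, eval_aeval_F3] at E
    simp only [eval_linF, Matrix.mulVec_mulVec, hA, Matrix.one_mulVec, Pi.add_apply, Pi.smul_apply, smul_eq_mul] at E
    exact E
  have hd := col_ne_zero A A' hA' m
  have e1 := H ![0, 0, 0] 1
  have e2 := H ![0, 1, 0] 1
  have e3 := H ![0, 2, 0] 1
  have e4 := H ![0, 0, 1] 1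
  revert hd e1 e2 e3 e4
  generalize A 0 m = d0
  generalize A 1 m = d1
  generalize A 2 m = d2
  revert d0 d1 d2
  decide

/-! ## Class `W`: `W₁³W₂` has no invariant direction over `𝔽₃` -/

/-- The `W`-carrying part of the truncation at `¼`: `W₁³W₂` (derived here; the sign `−1` is irrelevant for occurrence). [cite: AbramovichTemkinWlodarczyk2024, §5.1 (p. 1575)] -/
noncomputable def GW : MvPolynomial (Fin 2) (ZMod 3) := X 0 ^ 3 * X 1

/-- The linear substitution `W ↦ B W` (derived here). [cite: Lang2002, Ch. IV §1] -/
noncomputable def linW (B : Matrix (Fin 2) (Fin 2) (ZMod 3)) : Fin 2 → MvPolynomial (Fin 2) (ZMod 3) :=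
  fun i => C (B i 0) * X 0 + C (B i 1) * X 1

/-- Values of `W₁³W₂∘Π` (bookkeeping). [cite: Lang2002, Ch. IV §1] -/
theorem eval_aeval_GW (π : Fin 2 → MvPolynomial (Fin 2) (ZMod 3)) (ε : Fin 2 → ZMod 3) :
    eval ε (aeval π GW) = eval ε (π 0) ^ 3 * eval ε (π 1) := by
  simp only [GW, map_mul, map_pow, aeval_X]

/-- Values of the linear forms (bookkeeping). [cite: Lang2002, Ch. IV §1] -/
theorem eval_linW (B : Matrix (Fin 2) (Fin 2) (ZMod 3)) (ε : Fin 2 → ZMod 3) (i : Fin 2) :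
    eval ε (linW B i) = (B.mulVec ε) i := by
  simp [linW, Matrix.mulVec, dotProduct, Fin.sum_univ_two]

/-- A column of an invertible `2×2` matrix is nonzero (bookkeeping). [cite: Lang2002, Ch. III §5] -/
theorem col_ne_zero₂ (B B' : Matrix (Fin 2) (Fin 2) (ZMod 3)) (hB' : B' * B = 1) (m : Fin 2) : ¬ (B 0 m = 0 ∧ B 1 m = 0) := by
  rintro ⟨h0, h1⟩
  have h := congrFun (congrFun hB' m) m
  rw [Matrix.mul_apply, Fin.sum_univ_two, h0, h1, Matrix.one_apply_eq] at h
  simp at h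

/-- **CLASS `W`** (EXAMPLE L; `exL38`: "all 48 `B`, `(BW)₁³(BW)₂` involves both `W_j`"; derived here by proof): for `B` invertible, every `W_m`
occurs in `(BW)₁³(BW)₂`. [cite: AbramovichTemkinWlodarczyk2024, §5.1 (p. 1575)] -/
theorem mem_vars_GW_linW (B B' : Matrix (Fin 2) (Fin 2) (ZMod 3)) (hB : B * B' = 1) (hB' : B' * B = 1) (m : Fin 2) :
    m ∈ (aeval (linW B) GW).vars := by
  by_contra hm
  have H : ∀ (v : Fin 2 → ZMod 3) (s : ZMod 3), (v 0 + s * B 0 m) ^ 3 * (v 1 + s * B 1 m) = v 0 ^ 3 * v 1 := by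
    intro v s
    have E := eval_eq_eval_of_notMem_vars hm (B'.mulVec (v + s • fun j => B j m)) (B'.mulVec v)
      (fun i hi => mulVec_add_smul_col_apply B B' hB' m v s hi)
    rw [eval_aeval_GW, eval_aeval_GW] at E
    simp only [eval_linW, Matrix.mulVec_mulVec, hB, Matrix.one_mulVec, Pi.add_apply, Pi.smul_apply, smul_eq_mul] at E
    exact E
  have hd := col_ne_zero₂ B B' hB' m
  have e1 := H ![0, 0] 1
  have e2 := H ![1, 0] 1
  have e3 := H ![0, 1] 1
  revert hd e1 e2 e3
  generalize B 0 m = d0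
  generalize B 1 m = d1
  revert d0 d1
  decide

/-! ## Class `y` (bottom): `y` occurs in `g∘Π` for every structured graded substitution -/

/-- The graded substitutions of EXAMPLE L's weights: `f_i ↦ Σ_j A_{ij} f_j + c_i y²`, `W ↦ BW`, `y ↦ λy`, `σ ↦ σ` (derived here; that every graded
automorphism has this shape is the engine's weight count, not typed). [cite: AbramovichTemkinWlodarczyk2024, §5.1 (p. 1575)] -/
noncomputable def piL (A : Matrix (Fin 3) (Fin 3) (ZMod 3)) (c₀ c₁ c₂ : ZMod 3) (B : Matrix (Fin 2) (Fin 2) (ZMod 3)) (lam : ZMod 3) :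
    Fin 7 → MvPolynomial (Fin 7) (ZMod 3) :=
  ![C (A 0 0) * X 0 + C (A 0 1) * X 1 + C (A 0 2) * X 2 + C c₀ * X 5 ^ 2,
    C (A 1 0) * X 0 + C (A 1 1) * X 1 + C (A 1 2) * X 2 + C c₁ * X 5 ^ 2,
    C (A 2 0) * X 0 + C (A 2 1) * X 1 + C (A 2 2) * X 2 + C c₂ * X 5 ^ 2,
    C (B 0 0) * X 3 + C (B 0 1) * X 4,
    C (B 1 0) * X 3 + C (B 1 1) * X 4,
    C lam * X 5,
    X 6]

/-- The evaluation point `(f, W, y, σ) = (u, 0, t, 0)` (bookkeeping). [cite: Lang2002, Ch. IV §1] -/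
def pt (u : Fin 3 → ZMod 3) (t : ZMod 3) : Fin 7 → ZMod 3 := ![u 0, u 1, u 2, 0, 0, t, 0]

/-- Values of `g∘Π` (bookkeeping). [cite: Lang2002, Ch. IV §1] -/
theorem eval_aeval_gL (π : Fin 7 → MvPolynomial (Fin 7) (ZMod 3)) (ε : Fin 7 → ZMod 3) :
    eval ε (aeval π gL) = eval ε (π 0) ^ 3 - eval ε (π 3) ^ 3 * eval ε (π 4) + eval ε (π 1) ^ 2 * eval ε (π 2)
      + eval ε (π 5) ^ 2 * eval ε (π 2) ^ 2 + eval ε (π 5) ^ 6 := by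
  simp only [gL, map_add, map_sub, map_mul, map_pow, aeval_X]

/-- Values of the structured substitution at `(u, 0, t, 0)` (bookkeeping). [cite: Lang2002, Ch. IV §1] -/
theorem eval_piL (A : Matrix (Fin 3) (Fin 3) (ZMod 3)) (c₀ c₁ c₂ : ZMod 3) (B : Matrix (Fin 2) (Fin 2) (ZMod 3)) (lam : ZMod 3)
    (u : Fin 3 → ZMod 3) (t : ZMod 3) :
    eval (pt u t) (piL A c₀ c₁ c₂ B lam 0) = (A.mulVec u) 0 + c₀ * t ^ 2 ∧
    eval (pt u t) (piL A c₀ c₁ c₂ B lam 1) = (A.mulVec u) 1 + c₁ * t ^ 2 ∧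
    eval (pt u t) (piL A c₀ c₁ c₂ B lam 2) = (A.mulVec u) 2 + c₂ * t ^ 2 ∧
    eval (pt u t) (piL A c₀ c₁ c₂ B lam 3) = 0 ∧ eval (pt u t) (piL A c₀ c₁ c₂ B lam 4) = 0 ∧
    eval (pt u t) (piL A c₀ c₁ c₂ B lam 5) = lam * t := by
  simp [piL, pt, Matrix.mulVec, dotProduct, Fin.sum_univ_three]

/-- **CLASS `y`** (EXAMPLE L; `exL38`: "all 303 264 pairs `(A, c)`: `y` occurs in `g∘Π`"; the hand proof: the `y²`-part of `g∘Π` is the nonzero form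
`λ²u₃² + 2c₂u₂u₃ + c₃u₂²`; derived here by proof for all `A` invertible, all `c`, all `B`, all `λ ≠ 0`): `y ∈ vars (g∘Π)`.  Proof: otherwise the
value at `(A'v, 0, t, 0)` is independent of `t`; at `v = (0,0,s)` this reads `c₀³ + c₁²(s + c₂) + λ²(s + c₂)² + λ⁶ = 0` for `s = 0, 1, 2`, which no
`(c, λ)` with `λ ≠ 0` satisfies. [cite: AbramovichTemkinWlodarczyk2024, §5.1 (p. 1575)] -/
theorem mem_vars_gL_piL (A A' : Matrix (Fin 3) (Fin 3) (ZMod 3)) (hA : A * A' = 1) (c₀ c₁ c₂ : ZMod 3)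
    (B : Matrix (Fin 2) (Fin 2) (ZMod 3)) (lam : ZMod 3) (hlam : lam ≠ 0) :
    (5 : Fin 7) ∈ (aeval (piL A c₀ c₁ c₂ B lam) gL).vars := by
  by_contra hy
  have H : ∀ (v : Fin 3 → ZMod 3) (t : ZMod 3),
      (v 0 + c₀ * t ^ 2) ^ 3 - 0 ^ 3 * 0 + (v 1 + c₁ * t ^ 2) ^ 2 * (v 2 + c₂ * t ^ 2)
        + (lam * t) ^ 2 * (v 2 + c₂ * t ^ 2) ^ 2 + (lam * t) ^ 6
      = (v 0 + c₀ * 0 ^ 2) ^ 3 - 0 ^ 3 * 0 + (v 1 + c₁ * 0 ^ 2) ^ 2 * (v 2 + c₂ * 0 ^ 2)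
        + (lam * 0) ^ 2 * (v 2 + c₂ * 0 ^ 2) ^ 2 + (lam * 0) ^ 6 := by
    intro v t
    have h5 : ∀ i : Fin 7, i ≠ 5 → pt (A'.mulVec v) t i = pt (A'.mulVec v) 0 i := by
      intro i hi
      fin_cases i <;> simp_all [pt]
    have E := eval_eq_eval_of_notMem_vars hy _ _ h5
    obtain ⟨h0, h1, h2, h3, h4, h5'⟩ := eval_piL A c₀ c₁ c₂ B lam (A'.mulVec v) t
    obtain ⟨k0, k1, k2, k3, k4, k5⟩ := eval_piL A c₀ c₁ c₂ B lam (A'.mulVec v) 0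
    rw [eval_aeval_gL, eval_aeval_gL, h0, h1, h2, h3, h4, h5', k0, k1, k2, k3, k4, k5, Matrix.mulVec_mulVec, hA,
      Matrix.one_mulVec] at E
    exact E
  have e0 := H ![0, 0, 0] 1
  have e1 := H ![0, 0, 1] 1
  have e2 := H ![0, 0, 2] 1
  clear H hy
  revert hlam e0 e1 e2
  revert c₀ c₁ c₂ lam
  decide

end ExampleL

end Literature.AlgebraicGeometry.Resolution.WeightedBlowup
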